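import Mathlib
import Literature.Analysis.FluidPDE.VectorCalculus
import Literature.Analysis.FluidPDE.VorticityCalculus
import Literature.Analysis.FluidPDE.AxisymmetricEuler
import Literature.Analysis.FluidPDE.SwirlTransportProofs
import Literature.Analysis.FluidPDE.LandauSolutions
import Literature.Analysis.FluidPDE.SverakLandauClassification
import Summits.NavierStokesRegularity.NavierStokesRegularity.Theorems.ThreadingFluxCentreJetDefs
import Summits.NavierStokesRegularity.NavierStokesRegularity.Theorems.ThreadingFluxSilentShellsTwoAxesTools
import Summits.NavierStokesRegularity.NavierStokesRegularity.Theorems.LandauTailHomSteadyProfileExistsProfile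
import Summits.NavierStokesRegularity.NavierStokesRegularity.Theorems.LandauTailHomSteadyProfileExistsMomentum
import HarnessLib

/-!
# Crux `PoloidalLiouville` (stmt-NavierStokesRegularity-1222, W1), crux idea «azimuthal-cartan-test» (ns-idea-15 g10, V26):
# TOOLS for (L) `LandauBaseFacts` — pointwise facts about the Landau flow `landauAxisField e₂ 2` off the origin

Lemmas feeding `ThreadingFluxAzimuthalCartanLandauBaseFacts.lean` (the by-name statements live there), tree tools only:

* `LandauBase.analyticAt_landauAxisField/Pressure` — real-analyticity off the origin: the tree's `LandauTail.contDiffAt_landauAxisField/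
  Pressure` hold for every `n : WithTop ℕ∞`, in particular `n = ω`, and `ContDiffAt ℝ ω` IS real-analyticity (`ContDiffAt.analyticAt`);
* `LandauBase.isSteadyNSOn_landauAxisField` — the tree's pointwise steady system `IsSteadyNSOn` (`ThreadingFluxCentreJetDefs`) on any set
  missing the origin, from `LandauTail.landauAxisField_momentum` (`(U·∇)U + ∇P = ΔU`, Landau 1944) and `LandauTail.divergence_landauAxisField`;
* the rotation generator `J₃ = crossCLM e₂ = rotGen`: skew, non-zero, kills the axis; infinitesimal equivariance `DU(x)(e₂ × (x − t e₂)) =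
  e₂ × U(x)` (`IsAxisymmetric.fderiv_rotGen` on `isAxisymmetric_landauSolution`) and no swirl (`hasNoSwirl_landauSolution`);
* membership: the test ball `B((3,0,4),1)` and the solid torus `{x | dist (axialCoords 0 e₂ x) (3,4) < 1}` (sketch v1.3b `landauTorus`,
  δ-unfolded) miss the origin; `x₁ = (3,0,4)` lies in the torus; `|x₁| = 5`;
* ★ `LandauBase.fderiv_landauAxisPressure_apply` — the explicit directional derivative of Landau's pressure off the origin (product/chain
  rules over `hasFDerivAt_norm_of_ne_zero`, `hasFDerivAt_landauDen`, `hasDerivAt_inv`); with `LandauTail.fderiv_landauAxisField_apply` and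
  `fderiv_landauBeta_apply`: `(curl U (x₁))₁ = 1/6` (`curl_landau2_xTest_apply_one`), `(DU(x₁) e₂)₀ = 1/250`, Euler's relation
  `DU(x) x = −U(x)` (`fderiv_landauAxisField_self`), hence `curl U (x₁) ≠ 0` and NON-homogeneity about the off-vertex centre `e₂` on balls
  about `x₁` (`not_homogeneous_about_e2`).

Information for the negation lens only; `PoloidalLiouville` (1222) and NS regularity stay OPEN / NOT proved.
`--supports stmt-NavierStokesRegularity-1222 --as helper`; 0 kit.  [folklore]
-/

-- the summit and its single problem share the name (D-0017 nested layout)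
set_option linter.dupNamespace false

noncomputable section

open Set Function Metric
open scoped RealInnerProductSpace
open Literature.Analysis.FluidPDE

namespace Summit.NavierStokesRegularity.NavierStokesRegularity.Theorems.PoloidalLiouville.AzimuthalCartan

open Summit.NavierStokesRegularity.NavierStokesRegularity.Theorems
open Summit.NavierStokesRegularity.NavierStokesRegularity.Theorems.PoloidalLiouville.CentreJet (E3 IsSteadyNSOn)
open Summit.NavierStokesRegularity.NavierStokesRegularity.Theorems.LandauTail

namespace LandauBase

/-! ### The axis, the test point, the test ball -/

/-- `‖e₂‖ = 1`. [folklore] -/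
theorem norm_e2 : ‖(EuclideanSpace.single 2 1 : E3)‖ = 1 := by simp

/-- `1 < |2|`. [folklore] -/
theorem one_lt_abs_two : (1 : ℝ) < |2| := by norm_num

/-- `|x₁| = 5` for the test point `x₁ = (3,0,4)`. [folklore] -/
theorem norm_xTest' : ‖(EuclideanSpace.single 0 3 + EuclideanSpace.single 2 4 : E3)‖ = 5 := by
  have h : ‖(EuclideanSpace.single 0 3 + EuclideanSpace.single 2 4 : E3)‖ ^ 2 = 25 := by
    rw [EuclideanSpace.norm_sq_eq]
    simp [Fin.sum_univ_three]
    norm_num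
  nlinarith [norm_nonneg (EuclideanSpace.single 0 3 + EuclideanSpace.single 2 4 : E3)]

/-- The test ball `B((3,0,4), 1)` misses the origin (the third coordinate stays above `3`). [folklore] -/
theorem ne_zero_of_mem_ball {y : E3} (hy : y ∈ ball (EuclideanSpace.single 0 3 + EuclideanSpace.single 2 4 : E3) 1) : y ≠ 0 := by
  intro h0
  rw [h0, mem_ball, dist_eq_norm, zero_sub, norm_neg] at hy
  have h2 : ‖(EuclideanSpace.single 0 3 + EuclideanSpace.single 2 4 : E3) 2‖ ≤
      ‖(EuclideanSpace.single 0 3 + EuclideanSpace.single 2 4 : E3)‖ := PiLp.norm_apply_le _ 2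
  have h3 : ‖(EuclideanSpace.single 0 3 + EuclideanSpace.single 2 4 : E3) 2‖ = 4 := by
    simp
  linarith

/-- The solid torus of the computation (sketch v1.2 `landauTorus = solidTorus 0 e3 (3,4) 1`, δ-unfolded): sup-distance of the axial
coordinates `(ρ, z) = (√(|x|² − ⟪x,e₂⟫²/|e₂|²), ⟪x,e₂⟫/|e₂|)` to `(3,4)` less than `1`.  Points of it have `z > 3`, hence are `≠ 0`. [folklore] -/
theorem ne_zero_of_mem_torus {y : E3}
    (hy : y ∈ {x : E3 | dist (Real.sqrt (‖x - 0‖ ^ 2 - (inner ℝ (x - 0) (EuclideanSpace.single 2 1 : E3)) ^ 2 /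
        ‖(EuclideanSpace.single 2 1 : E3)‖ ^ 2), inner ℝ (x - 0) (EuclideanSpace.single 2 1 : E3) /
        ‖(EuclideanSpace.single 2 1 : E3)‖) ((3 : ℝ), (4 : ℝ)) < 1}) : y ≠ 0 := by
  intro h0
  rw [Set.mem_setOf_eq, h0, Prod.dist_eq] at hy
  have h2 := (max_lt_iff.1 hy).2
  rw [Real.dist_eq] at h2
  simp at h2

/-- The test point `(3,0,4)` lies in the solid torus (its axial coordinates are exactly `(3,4)`). [folklore] -/
theorem xTest_mem_torus :
    (EuclideanSpace.single 0 3 + EuclideanSpace.single 2 4 : E3) ∈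
      {x : E3 | dist (Real.sqrt (‖x - 0‖ ^ 2 - (inner ℝ (x - 0) (EuclideanSpace.single 2 1 : E3)) ^ 2 /
        ‖(EuclideanSpace.single 2 1 : E3)‖ ^ 2), inner ℝ (x - 0) (EuclideanSpace.single 2 1 : E3) /
        ‖(EuclideanSpace.single 2 1 : E3)‖) ((3 : ℝ), (4 : ℝ)) < 1} := by
  rw [Set.mem_setOf_eq, sub_zero, norm_xTest', norm_e2]
  have hi : inner ℝ (EuclideanSpace.single 0 3 + EuclideanSpace.single 2 4 : E3) (EuclideanSpace.single 2 1 : E3) = 4 := by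
    rw [EuclideanSpace.inner_single_right]; simp
  rw [hi]
  have hs : Real.sqrt ((5 : ℝ) ^ 2 - 4 ^ 2 / 1 ^ 2) = 3 := by
    rw [show ((5 : ℝ) ^ 2 - 4 ^ 2 / 1 ^ 2) = 3 ^ 2 by norm_num, Real.sqrt_sq (by norm_num)]
  rw [hs]
  norm_num

/-! ### Analyticity and the steady system off the origin -/

/-- Landau's flow is real-analytic off the origin (`ContDiffAt ℝ ω` from the tree). [folklore] -/
theorem analyticAt_landauAxisField {a : E3} (ha : ‖a‖ = 1) {c : ℝ} (hc : 1 < |c|) {x : E3} (hx : x ≠ 0) :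
    AnalyticAt ℝ (landauAxisField a c) x :=
  (contDiffAt_landauAxisField ha hc hx (n := (⊤ : WithTop ℕ∞))).analyticAt

/-- Landau's pressure is real-analytic off the origin. [folklore] -/
theorem analyticAt_landauAxisPressure {a : E3} (ha : ‖a‖ = 1) {c : ℝ} (hc : 1 < |c|) {x : E3} (hx : x ≠ 0) :
    AnalyticAt ℝ (landauAxisPressure a c) x :=
  (contDiffAt_landauAxisPressure ha hc hx (n := (⊤ : WithTop ℕ∞))).analyticAt

/-- Landau's flow solves the steady unit-viscosity Navier–Stokes system, in the tree's pointwise sense `IsSteadyNSOn`, on every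
set missing the origin. [folklore] -/
theorem isSteadyNSOn_landauAxisField {a : E3} (ha : ‖a‖ = 1) {c : ℝ} (hc : 1 < |c|) {U : Set E3} (hU : ∀ x ∈ U, x ≠ 0) :
    IsSteadyNSOn U (landauAxisField a c) (landauAxisPressure a c) := by
  refine ⟨?_, ?_, fun x hx => divergence_landauAxisField ha hc (hU x hx), fun x hx => ?_⟩
  · exact fun x hx => (contDiffAt_landauAxisField ha hc (hU x hx)).contDiffWithinAt
  · exact fun x hx => (contDiffAt_landauAxisPressure ha hc (hU x hx)).contDiffWithinAt
  · exact landauAxisField_momentum ha hc (hU x hx)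

/-! ### The rotation generator `J₃ = e₂ × ·`, equivariance, swirl -/

/-- `e₂ × y = rotGen y = (−y₁, y₀, 0)`. [folklore] -/
theorem crossCLM_e2_apply (y : E3) : crossCLM (EuclideanSpace.single 2 1) y = rotGen y := by
  rw [crossCLM_apply]
  ext i
  fin_cases i <;> simp [cross, crossProduct, rotGen]

/-- `⟪u, rotGen y⟫ = y₀ u₁ − y₁ u₀` (the swirl pairing). [folklore] -/
theorem inner_rotGen_right (u y : E3) : ⟪u, rotGen y⟫ = y 0 * u 1 - y 1 * u 0 := by
  simp only [PiLp.inner_apply, RCLike.inner_apply, conj_trivial, Fin.sum_univ_three, rotGen_apply_zero,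
    rotGen_apply_one, rotGen_apply_two]
  ring

/-- `J₃` is skew: `⟪e₂ × y, y⟫ = 0`. [folklore] -/
theorem inner_crossCLM_e2_self (y : E3) : ⟪crossCLM (EuclideanSpace.single 2 1) y, y⟫ = 0 := by
  rw [crossCLM_e2_apply, real_inner_comm, inner_rotGen_right]
  ring

/-- `J₃ ≠ 0` (`e₂ × e₀ = e₁`). [folklore] -/
theorem crossCLM_e2_ne_zero : crossCLM (EuclideanSpace.single 2 1 : E3) ≠ 0 := by
  intro h
  have h1 := DFunLike.congr_fun h (EuclideanSpace.single 0 1)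
  rw [crossCLM_e2_apply] at h1
  have h2 := congrArg (fun v : E3 => v 1) h1
  simp [rotGen] at h2

/-- The generator kills the axis: `e₂ × (t e₂) = 0`, so `J₃ (x − t e₂) = J₃ x` for a centre on the axis. [folklore] -/
theorem crossCLM_e2_sub_axis (x : E3) (t : ℝ) :
    crossCLM (EuclideanSpace.single 2 1) (x - t • (EuclideanSpace.single 2 1 : E3)) = crossCLM (EuclideanSpace.single 2 1) x := by
  rw [map_sub, map_smul, sub_eq_self, crossCLM_e2_apply]
  have : rotGen (EuclideanSpace.single 2 1 : E3) = 0 := by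
    ext i; fin_cases i <;> simp [rotGen]
  rw [this, smul_zero]

/-- Infinitesimal axisymmetry of Landau's flow about `e₂`, centre `t e₂` on the axis: `DU(x)(e₂ × (x − t e₂)) = e₂ × U(x)` off the
origin (the derivative at `θ = 0` of `U (R_θ x) = R_θ U(x)`). [folklore] -/
theorem fderiv_landau_crossCLM_e2 {c : ℝ} (hc : 1 < |c|) {x : E3} (hx : x ≠ 0) (t : ℝ) :
    fderiv ℝ (landauAxisField (EuclideanSpace.single 2 1) c) x
        (crossCLM (EuclideanSpace.single 2 1) (x - t • (EuclideanSpace.single 2 1 : E3))) =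
      crossCLM (EuclideanSpace.single 2 1) (landauAxisField (EuclideanSpace.single 2 1) c x) := by
  rw [crossCLM_e2_sub_axis, crossCLM_e2_apply, crossCLM_e2_apply]
  have hax : IsAxisymmetric (landauAxisField (EuclideanSpace.single 2 1) c) := by
    have h := isAxisymmetric_landauSolution (ν := 1) (A := c)
    rwa [landauSolution_one] at h
  exact hax.fderiv_rotGen ((contDiffAt_landauAxisField norm_e2 hc hx (n := 1)).differentiableAt one_ne_zero)

/-- No swirl about a centre `t e₂` on the axis: `⟪U x, e₂ × (x − t e₂)⟫ = 0`. [folklore] -/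
theorem inner_landau_crossCLM_e2 (c : ℝ) (x : E3) (t : ℝ) :
    ⟪landauAxisField (EuclideanSpace.single 2 1) c x,
      crossCLM (EuclideanSpace.single 2 1) (x - t • (EuclideanSpace.single 2 1 : E3))⟫ = 0 := by
  rw [crossCLM_e2_sub_axis, crossCLM_e2_apply, inner_rotGen_right]
  have h := hasNoSwirl_landauSolution (ν := 1) (A := c) x
  rw [landauSolution_one] at h
  simp only [swirl] at h
  rw [show eZ = (EuclideanSpace.single 2 1 : E3) from rfl] at h
  linarith

/-! ### The vorticity at the test point -/

/-- **Directional derivative of Landau's pressure** off the origin: with `N = c⟪a,·⟫ − |·|`, `D = c|·| − ⟪a,·⟫`, `M = |·| D²`,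
`P = 4N/M`, for `x ≠ 0` and any `v`,
`DP(x) v = 4N(x) · (−M(x)⁻²) · DM(x)v + M(x)⁻¹ · 4 DN(x)v` with `DN(x)v = c⟪a,v⟫ − ⟪x,v⟫/|x|`,
`DD(x)v = ⟪(c/|x|)x − a, v⟫`, `DM(x)v = |x|(D·DDv + D·DDv) + D²⟪x,v⟫/|x|` (product and chain rules over the tree's
`hasFDerivAt_norm_of_ne_zero`, `hasFDerivAt_landauDen`, Mathlib `hasDerivAt_inv`). [folklore] -/
theorem fderiv_landauAxisPressure_apply {a : E3} (ha : ‖a‖ = 1) {c : ℝ} (hc : 1 < |c|) {x : E3} (hx : x ≠ 0) (v : E3) :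
    fderiv ℝ (landauAxisPressure a c) x v =
      4 * (c * ⟪a, x⟫ - ‖x‖) *
          (-((‖x‖ * ((c * ‖x‖ - ⟪a, x⟫) * (c * ‖x‖ - ⟪a, x⟫))) ^ 2)⁻¹ *
            (‖x‖ * ((c * ‖x‖ - ⟪a, x⟫) * ⟪(c * ‖x‖⁻¹) • x - a, v⟫ + (c * ‖x‖ - ⟪a, x⟫) * ⟪(c * ‖x‖⁻¹) • x - a, v⟫) +
              (c * ‖x‖ - ⟪a, x⟫) * (c * ‖x‖ - ⟪a, x⟫) * (‖x‖⁻¹ * ⟪x, v⟫))) +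
        (‖x‖ * ((c * ‖x‖ - ⟪a, x⟫) * (c * ‖x‖ - ⟪a, x⟫)))⁻¹ * (4 * (c * ⟪a, v⟫ - ‖x‖⁻¹ * ⟪x, v⟫)) := by
  have hD0 : c * ‖x‖ - ⟪a, x⟫ ≠ 0 := landauAxis_denom_ne_zero ha hc hx
  have hr0 : ‖x‖ ≠ 0 := norm_ne_zero_iff.2 hx
  have hN : HasFDerivAt (fun y : E3 => 4 * (c * ⟪a, y⟫ - ‖y‖))
      ((4 : ℝ) • (c • (innerSL ℝ a : E3 →L[ℝ] ℝ) - ‖x‖⁻¹ • (innerSL ℝ x : E3 →L[ℝ] ℝ))) x := by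
    have h1 : HasFDerivAt (fun y : E3 => ⟪a, y⟫) (innerSL ℝ a : E3 →L[ℝ] ℝ) x := (innerSL ℝ a).hasFDerivAt
    exact ((h1.const_smul c).sub (hasFDerivAt_norm_of_ne_zero hx)).const_smul (4 : ℝ)
  have hD : HasFDerivAt (fun y : E3 => c * ‖y‖ - ⟪a, y⟫)
      (innerSL ℝ ((c * ‖x‖⁻¹) • x - a) : E3 →L[ℝ] ℝ) x := hasFDerivAt_landauDen c a hx
  have hM : HasFDerivAt (fun y : E3 => ‖y‖ * ((c * ‖y‖ - ⟪a, y⟫) * (c * ‖y‖ - ⟪a, y⟫)))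
      (‖x‖ • ((c * ‖x‖ - ⟪a, x⟫) • (innerSL ℝ ((c * ‖x‖⁻¹) • x - a) : E3 →L[ℝ] ℝ) +
          (c * ‖x‖ - ⟪a, x⟫) • (innerSL ℝ ((c * ‖x‖⁻¹) • x - a) : E3 →L[ℝ] ℝ)) +
        ((c * ‖x‖ - ⟪a, x⟫) * (c * ‖x‖ - ⟪a, x⟫)) • (‖x‖⁻¹ • (innerSL ℝ x : E3 →L[ℝ] ℝ))) x :=
    (hasFDerivAt_norm_of_ne_zero hx).mul (hD.mul hD)
  have hM0 : ‖x‖ * ((c * ‖x‖ - ⟪a, x⟫) * (c * ‖x‖ - ⟪a, x⟫)) ≠ 0 := mul_ne_zero hr0 (mul_ne_zero hD0 hD0)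
  have hMinv := (hasDerivAt_inv hM0).comp_hasFDerivAt x hM
  have hP := hN.mul hMinv
  have e : landauAxisPressure a c = fun y : E3 =>
      4 * (c * ⟪a, y⟫ - ‖y‖) * (‖y‖ * ((c * ‖y‖ - ⟪a, y⟫) * (c * ‖y‖ - ⟪a, y⟫)))⁻¹ := by
    funext y
    simp only [landauAxisPressure, div_eq_mul_inv, pow_two]
  have e2 : (fun y : E3 => 4 * (c * ⟪a, y⟫ - ‖y‖) * (‖y‖ * ((c * ‖y‖ - ⟪a, y⟫) * (c * ‖y‖ - ⟪a, y⟫)))⁻¹) =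
      (fun y : E3 => 4 * (c * ⟪a, y⟫ - ‖y‖)) *
        ((fun t : ℝ => t⁻¹) ∘ fun y : E3 => ‖y‖ * ((c * ‖y‖ - ⟪a, y⟫) * (c * ‖y‖ - ⟪a, y⟫))) := by
    funext y
    simp only [Pi.mul_apply, Function.comp_apply]
  rw [e, e2, hP.fderiv]
  simp only [add_apply, smul_apply, sub_apply, innerSL_apply_apply, smul_eq_mul, Function.comp_apply]

/-! ### Numerics at the test point `x₁ = (3, 0, 4)` -/

/-- **The vorticity of Landau's flow at the test point**: the `e₁`-component of `curl U (x₁)` is `1/6`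
(`(curl U)₁ = (DU e₂)₀ − (DU e₀)₂`, the tree's derivative formula for `U` and the pressure derivative above). [folklore] -/
theorem curl_landau2_xTest_apply_one :
    curl (landauAxisField (EuclideanSpace.single 2 1) 2) (EuclideanSpace.single 0 3 + EuclideanSpace.single 2 4 : E3) 1 = 1 / 6 := by
  set x : E3 := EuclideanSpace.single 0 3 + EuclideanSpace.single 2 4 with hxdef
  set a : E3 := EuclideanSpace.single 2 1 with hadef
  have hx : x ≠ 0 := ne_zero_of_mem_ball (mem_ball_self one_pos)
  have ha : ‖a‖ = 1 := norm_e2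
  have hc : (1 : ℝ) < |2| := one_lt_abs_two
  have hr : ‖x‖ = 5 := norm_xTest'
  have hx0 : x 0 = 3 := by simp [hxdef]
  have hx1 : x 1 = 0 := by simp [hxdef]
  have hx2 : x 2 = 4 := by simp [hxdef]
  have ha0 : a 0 = 0 := by simp [hadef]
  have ha1 : a 1 = 0 := by simp [hadef]
  have ha2 : a 2 = 1 := by simp [hadef]
  have hax : ⟪a, x⟫ = 4 := by
    rw [hadef, EuclideanSpace.inner_single_left]; simp [hx2]
  -- the two directional derivatives of `U` entering `(curl U)₁`
  have hcurl : curl (landauAxisField a 2) x 1 =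
      fderiv ℝ (landauAxisField a 2) x (EuclideanSpace.single 2 1) 0 -
        fderiv ℝ (landauAxisField a 2) x (EuclideanSpace.single 0 1) 2 := by
    simp [curl]
  rw [hcurl, fderiv_landauAxisField_apply ha hc hx, fderiv_landauAxisField_apply ha hc hx,
    fderiv_landauAxisPressure_apply ha hc hx, fderiv_landauAxisPressure_apply ha hc hx,
    fderiv_landauBeta_apply ha hc hx, fderiv_landauBeta_apply ha hc hx]
  have i1 : ⟪a, (EuclideanSpace.single 2 1 : E3)⟫ = 1 := by rw [← hadef, real_inner_self_eq_norm_sq, ha]; norm_num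
  have i2 : ⟪a, (EuclideanSpace.single 0 1 : E3)⟫ = 0 := by rw [EuclideanSpace.inner_single_right]; simp [ha0]
  have i3 : ⟪x, (EuclideanSpace.single 2 1 : E3)⟫ = 4 := by rw [EuclideanSpace.inner_single_right]; simp [hx2]
  have i4 : ⟪x, (EuclideanSpace.single 0 1 : E3)⟫ = 3 := by rw [EuclideanSpace.inner_single_right]; simp [hx0]
  have i5 : ⟪((2 : ℝ) * ‖x‖⁻¹) • x - a, (EuclideanSpace.single 2 1 : E3)⟫ = 3 / 5 := by
    rw [inner_sub_left, inner_smul_left, i3, i1, hr]; norm_num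
  have i6 : ⟪((2 : ℝ) * ‖x‖⁻¹) • x - a, (EuclideanSpace.single 0 1 : E3)⟫ = 6 / 5 := by
    rw [inner_sub_left, inner_smul_left, i4, i2, hr]; norm_num
  have s20 : (EuclideanSpace.single 2 1 : E3) 0 = 0 := by simp
  have s02 : (EuclideanSpace.single 0 1 : E3) 2 = 0 := by simp
  rw [i5, i6]
  simp only [PiLp.add_apply, PiLp.smul_apply, smul_eq_mul, landauAxisPressure, i1, i2, i3, i4, s20, s02, hax, hr,
    hx0, hx2, ha0, ha2]
  norm_num

/-- `curl U (x₁) ≠ 0`. [folklore] -/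
theorem curl_landau2_xTest_ne_zero :
    curl (landauAxisField (EuclideanSpace.single 2 1) 2) (EuclideanSpace.single 0 3 + EuclideanSpace.single 2 4 : E3) ≠ 0 := by
  intro h
  have h1 := congrArg (fun v : E3 => v 1) h
  simp only [curl_landau2_xTest_apply_one, PiLp.zero_apply] at h1
  norm_num at h1

/-- **The axial derivative of Landau's flow at the test point does not vanish**: `(DU(x₁) e₂)₀ = 1/250`. [folklore] -/
theorem fderiv_landau2_xTest_e2_apply_zero :
    fderiv ℝ (landauAxisField (EuclideanSpace.single 2 1) 2) (EuclideanSpace.single 0 3 + EuclideanSpace.single 2 4 : E3)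
      (EuclideanSpace.single 2 1) 0 = 1 / 250 := by
  set x : E3 := EuclideanSpace.single 0 3 + EuclideanSpace.single 2 4 with hxdef
  set a : E3 := EuclideanSpace.single 2 1 with hadef
  have hx : x ≠ 0 := ne_zero_of_mem_ball (mem_ball_self one_pos)
  have ha : ‖a‖ = 1 := norm_e2
  have hc : (1 : ℝ) < |2| := one_lt_abs_two
  have hr : ‖x‖ = 5 := norm_xTest'
  have hx0 : x 0 = 3 := by simp [hxdef]
  have hx2 : x 2 = 4 := by simp [hxdef]
  have ha0 : a 0 = 0 := by simp [hadef]
  have hax : ⟪a, x⟫ = 4 := by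
    rw [hadef, EuclideanSpace.inner_single_left]; simp [hx2]
  rw [fderiv_landauAxisField_apply ha hc hx, fderiv_landauAxisPressure_apply ha hc hx, fderiv_landauBeta_apply ha hc hx]
  have i1 : ⟪a, (EuclideanSpace.single 2 1 : E3)⟫ = 1 := by rw [← hadef, real_inner_self_eq_norm_sq, ha]; norm_num
  have i3 : ⟪x, (EuclideanSpace.single 2 1 : E3)⟫ = 4 := by rw [EuclideanSpace.inner_single_right]; simp [hx2]
  have i5 : ⟪((2 : ℝ) * ‖x‖⁻¹) • x - a, (EuclideanSpace.single 2 1 : E3)⟫ = 3 / 5 := by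
    rw [inner_sub_left, inner_smul_left, i3, i1, hr]; norm_num
  have hxa : ⟪x, a⟫ = 4 := by rw [real_inner_comm]; exact hax
  rw [i5]
  have haa : ⟪a, a⟫ = 1 := by rw [real_inner_self_eq_norm_sq, ha]; norm_num
  simp only [PiLp.add_apply, PiLp.smul_apply, smul_eq_mul, landauAxisPressure, hax, hxa, haa, hr, hx0, ha0]
  norm_num

/-- **Euler's relation for Landau's flow** (homogeneous of degree `−1` about the vertex): `DU(x) x = −U(x)` off the origin
(`DU(x)x = (P/2)x + ½(DP(x)x) x + (Dβ(x)x) a` with `DP(x)x = −2P(x)`, `Dβ(x)x = −β(x)`). [folklore] -/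
theorem fderiv_landauAxisField_self {a : E3} (ha : ‖a‖ = 1) {c : ℝ} (hc : 1 < |c|) {x : E3} (hx : x ≠ 0) :
    fderiv ℝ (landauAxisField a c) x x = -landauAxisField a c x := by
  rw [fderiv_landauAxisField_apply ha hc hx, fderiv_landauAxisPressure_self ha hc hx, fderiv_landauBeta_self ha hc hx]
  conv_rhs => rw [landauAxisField_eq ha hc]
  simp only [neg_add, neg_smul]
  module

/-- **Landau's flow is NOT `(−1)`-homogeneous about the off-vertex centre `e₂` on any ball about the test point** (`ρ > 0`): homogeneity
about `e₂` together with Euler's relation about the vertex `0` would force `DU(x₁) e₂ = 0`, but `(DU(x₁) e₂)₀ = 1/250`. [folklore] -/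
theorem not_homogeneous_about_e2 {ρ : ℝ} (hρ : 0 < ρ) :
    ¬ ∀ x ∈ ball (EuclideanSpace.single 0 3 + EuclideanSpace.single 2 4 : E3) ρ,
        fderiv ℝ (landauAxisField (EuclideanSpace.single 2 1) 2) x (x - EuclideanSpace.single 2 1) =
          -(landauAxisField (EuclideanSpace.single 2 1) 2 x) := by
  intro h
  have hx : (EuclideanSpace.single 0 3 + EuclideanSpace.single 2 4 : E3) ≠ 0 := ne_zero_of_mem_ball (mem_ball_self one_pos)
  have h1 := h _ (mem_ball_self hρ)
  rw [map_sub, fderiv_landauAxisField_self norm_e2 one_lt_abs_two hx, sub_eq_self] at h1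
  have h2 := congrArg (fun v : E3 => v 0) h1
  simp only [fderiv_landau2_xTest_e2_apply_zero, PiLp.zero_apply] at h2
  norm_num at h2

end LandauBase

end Summit.NavierStokesRegularity.NavierStokesRegularity.Theorems.PoloidalLiouville.AzimuthalCartan
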